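import Summits.Ventures.HodgeRepro2.T5SU11LegendreSeriesRate
import Summits.Ventures.HodgeRepro2.T5SU11LegendreDerivativeSum
import Mathlib.Analysis.Calculus.SmoothSeries

/-!
# Termwise differentiation of the Legendre series of a `C⁴` function: `f′ = Σ_k c_k(f) P′_k` uniformly on `[−1, 1]`

For `f` four times differentiable on `[−1, 1]` with continuous fourth derivative (`h₁`–`h₄`, `h₄c` as in row 425)
the coefficients satisfy `c_k(f) = c_k(L²f)/(k(k + 1))²` (row 425), and Markov's bound `|P′_k| ≤ k(k + 1)/2` on
`[−1, 1]` (row 404) gives `|c_k(f) P′_k(x)| ≤ |c_k(L²f)|/(2k(k + 1))`, which is summable by Cauchy–Schwarz and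
Bessel (`summable_abs_fourierLegendre_mul_deriv_bound`). Hence the differentiated series `Σ_k c_k(f) P′_k`
converges uniformly on `[−1, 1]`, and Mathlib's theorem on the derivative of a uniformly convergent series of
differentiable functions (`hasDerivAt_tsum_of_isPreconnected`, on the open interval `(−1, 1)`) identifies its sum
with `f′` (row 423: `f = Σ_k c_k(f) P_k` on `[−1, 1]`); continuity extends the identity to the closed interval:

  **`f′(x) = Σ_k c_k(f) P′_k(x)` for every `x ∈ [−1, 1]`**   (`eqOn_deriv_tsum`, `hasSum_fourierLegendre_mul_legQ`),
  **`(S_d f)′ → f′` uniformly on `[−1, 1]`**   (`tendstoUniformlyOn_partialSumDeriv`),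

with `(S_d f)′ = Σ_{k ≤ d} c_k(f) P′_k` (`partialSumDeriv`, `hasDerivAt_partialSum`), and the same for every
`f ∈ C⁴(ℝ)` (`eqOn_deriv_tsum_of_contDiff`). Nothing is claimed about (N).

Blind lane: Mathlib + the HodgeRepro2 prefix only; no sorry; axioms ⊆ {propext, Classical.choice,
Quot.sound}.
-/

namespace Summit.Ventures.HodgeRepro2.T5SU11LegendreSeriesDeriv

open Polynomial intervalIntegral Finset Filter Topology MeasureTheory
open Set (Icc Ioc Ioo uIcc uIoc EqOn)
open T5SU11SphericalLegendreAll T5SU11LegendreIdentities T5SU11LegendreOrthogonal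
  T5SU11LegendreSeries T5SU11LegendreCoefficientDecay T5SU11LegendreSeriesUniform T5SU11LegendreSeriesRate
  T5SU11LegendreDerivativeSum

/-! ### The differentiated partial sums -/

/-- **`(S_d f)′ = Σ_{k ≤ d} c_k(f) P′_k`**, the derivative of the `d`-th partial Legendre series. -/
noncomputable def partialSumDeriv (f : ℝ → ℝ) (d : ℕ) (x : ℝ) : ℝ :=
  ∑ k ∈ range (d + 1), fourierLegendre f k * legQ k x

/-- `S_d f` has derivative `(S_d f)′` everywhere. -/
theorem hasDerivAt_partialSum (f : ℝ → ℝ) (d : ℕ) (x : ℝ) :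
    HasDerivAt (partialSum f d) (partialSumDeriv f d x) x := by
  have : partialSum f d = fun x => ∑ k ∈ range (d + 1), fourierLegendre f k * legP k x := rfl
  rw [this, partialSumDeriv]
  have h := HasDerivAt.sum (u := range (d + 1)) (A := fun k y => fourierLegendre f k * legP k y)
    (A' := fun k => fourierLegendre f k * legQ k x) fun k _ => (hasDerivAt_legP k x).const_mul _
  refine h.congr_of_eventuallyEq (Filter.Eventually.of_forall fun y => ?_)
  simp only [Finset.sum_apply]

/-- `|c_k P′_k(x)| ≤ |c_k| · k(k + 1)/2` on `[−1, 1]` (Markov, row 404). -/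
theorem norm_deriv_term_le (f : ℝ → ℝ) (k : ℕ) {x : ℝ} (hx : x ∈ Icc (-1 : ℝ) 1) :
    ‖fourierLegendre f k * legQ k x‖ ≤ |fourierLegendre f k| * ((k : ℝ) * (k + 1) / 2) := by
  rw [Real.norm_eq_abs, abs_mul]
  exact mul_le_mul_of_nonneg_left (abs_legQ_le k hx) (abs_nonneg _)

section C4

variable {f f₁ f₂ f₃ f₄ : ℝ → ℝ}
  (h₁ : ∀ x ∈ Icc (-1 : ℝ) 1, HasDerivAt f (f₁ x) x)
  (h₂ : ∀ x ∈ Icc (-1 : ℝ) 1, HasDerivAt f₁ (f₂ x) x)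
  (h₃ : ∀ x ∈ Icc (-1 : ℝ) 1, HasDerivAt f₂ (f₃ x) x)
  (h₄ : ∀ x ∈ Icc (-1 : ℝ) 1, HasDerivAt f₃ (f₄ x) x)
  (h₄c : ContinuousOn f₄ (Icc (-1 : ℝ) 1))

include h₁ h₂ h₃ h₄ h₄c in
/-- **The partial sums of `|c_k(f)| k(k + 1)/2` are bounded** by `√2 · √(∫ (L²f)²)` (Cauchy–Schwarz with
`|c_k(f)| k(k + 1)/2 = |c_k(L²f)|/(2k(k + 1))`, Bessel for `L²f`, `Σ_{k≥1} 1/k² ≤ 2`). -/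
theorem sum_abs_fourierLegendre_mul_le (n : ℕ) :
    ∑ k ∈ range n, |fourierLegendre f k| * ((k : ℝ) * (k + 1) / 2)
      ≤ Real.sqrt 2 * Real.sqrt (∫ x in (-1 : ℝ)..1, sturm2 f₁ f₂ f₃ f₄ x ^ 2) := by
  set g := sturm2 f₁ f₂ f₃ f₄ with hg
  have hgc : ContinuousOn g (Icc (-1 : ℝ) 1) := continuousOn_sturm2 h₂ h₃ h₄ h₄c
  -- the `k = 0` term vanishes; on `Finset.Ioo 0 n` factorise
  have h1 : ∑ k ∈ range n, |fourierLegendre f k| * ((k : ℝ) * (k + 1) / 2)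
      ≤ ∑ k ∈ Finset.Ioo 0 n, |fourierLegendre f k| * ((k : ℝ) * (k + 1) / 2) := by
    have hsub : range n ⊆ insert 0 (Finset.Ioo 0 n) := by
      intro k hk
      rw [Finset.mem_insert, Finset.mem_Ioo]
      have := Finset.mem_range.mp hk
      omega
    have h0 : (0 : ℕ) ∉ Finset.Ioo 0 n := by simp
    calc ∑ k ∈ range n, |fourierLegendre f k| * ((k : ℝ) * (k + 1) / 2)
        ≤ ∑ k ∈ insert 0 (Finset.Ioo 0 n), |fourierLegendre f k| * ((k : ℝ) * (k + 1) / 2) :=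
          Finset.sum_le_sum_of_subset_of_nonneg hsub fun k _ _ => by positivity
      _ = ∑ k ∈ Finset.Ioo 0 n, |fourierLegendre f k| * ((k : ℝ) * (k + 1) / 2) := by
          rw [Finset.sum_insert h0]
          simp
  have h2 : ∀ k ∈ Finset.Ioo 0 n, |fourierLegendre f k| * ((k : ℝ) * (k + 1) / 2)
      = (|fourierLegendre g k| * Real.sqrt (2 / (2 * (k : ℝ) + 1)))
        * (Real.sqrt ((2 * (k : ℝ) + 1) / 2) / (2 * ((k : ℝ) * ((k : ℝ) + 1)))) := by
    intro k hk
    have hk1 : 1 ≤ k := Nat.succ_le_of_lt (Finset.mem_Ioo.mp hk).1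
    have hkpos : (0 : ℝ) < (k : ℝ) * ((k : ℝ) + 1) := by
      have : (1 : ℝ) ≤ (k : ℝ) := by exact_mod_cast hk1
      positivity
    rw [fourierLegendre_eq_sturm2 h₁ h₂ h₃ h₄ h₄c hk1, abs_div, abs_of_pos (pow_pos hkpos 2)]
    have hs : Real.sqrt (2 / (2 * (k : ℝ) + 1)) * Real.sqrt ((2 * (k : ℝ) + 1) / 2) = 1 := by
      rw [← Real.sqrt_mul (by positivity)]
      have : (2 / (2 * (k : ℝ) + 1)) * ((2 * (k : ℝ) + 1) / 2) = 1 := by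
        field_simp
      rw [this, Real.sqrt_one]
    calc |fourierLegendre g k| / ((k : ℝ) * ((k : ℝ) + 1)) ^ 2 * ((k : ℝ) * (k + 1) / 2)
        = |fourierLegendre g k| * (Real.sqrt (2 / (2 * (k : ℝ) + 1)) * Real.sqrt ((2 * (k : ℝ) + 1) / 2))
            / ((k : ℝ) * ((k : ℝ) + 1)) ^ 2 * ((k : ℝ) * (k + 1) / 2) := by rw [hs, mul_one]
      _ = _ := by field_simp
  have h3 : ∑ k ∈ Finset.Ioo 0 n, |fourierLegendre f k| * ((k : ℝ) * (k + 1) / 2)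
      ≤ Real.sqrt (∑ k ∈ Finset.Ioo 0 n, (|fourierLegendre g k| * Real.sqrt (2 / (2 * (k : ℝ) + 1))) ^ 2)
        * Real.sqrt (∑ k ∈ Finset.Ioo 0 n,
          (Real.sqrt ((2 * (k : ℝ) + 1) / 2) / (2 * ((k : ℝ) * ((k : ℝ) + 1)))) ^ 2) := by
    rw [Finset.sum_congr rfl h2]
    exact Real.sum_mul_le_sqrt_mul_sqrt _ _ _
  have h4 : ∑ k ∈ Finset.Ioo 0 n, (|fourierLegendre g k| * Real.sqrt (2 / (2 * (k : ℝ) + 1))) ^ 2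
      ≤ ∫ x in (-1 : ℝ)..1, g x ^ 2 := by
    have e : ∀ k ∈ Finset.Ioo 0 n, (|fourierLegendre g k| * Real.sqrt (2 / (2 * (k : ℝ) + 1))) ^ 2
        = fourierLegendre g k ^ 2 * (2 / (2 * (k : ℝ) + 1)) := by
      intro k _
      rw [mul_pow, sq_abs, Real.sq_sqrt (by positivity)]
    rw [Finset.sum_congr rfl e]
    calc ∑ k ∈ Finset.Ioo 0 n, fourierLegendre g k ^ 2 * (2 / (2 * (k : ℝ) + 1))
        ≤ ∑ k ∈ range (n + 1), fourierLegendre g k ^ 2 * (2 / (2 * (k : ℝ) + 1)) := by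
          refine Finset.sum_le_sum_of_subset_of_nonneg ?_ fun k _ _ => by positivity
          intro k hk
          rw [Finset.mem_range]
          have := (Finset.mem_Ioo.mp hk).2
          omega
      _ ≤ ∫ x in (-1 : ℝ)..1, g x ^ 2 := bessel hgc n
  have h5 : ∑ k ∈ Finset.Ioo 0 n,
      (Real.sqrt ((2 * (k : ℝ) + 1) / 2) / (2 * ((k : ℝ) * ((k : ℝ) + 1)))) ^ 2 ≤ 2 := by
    calc ∑ k ∈ Finset.Ioo 0 n, (Real.sqrt ((2 * (k : ℝ) + 1) / 2) / (2 * ((k : ℝ) * ((k : ℝ) + 1)))) ^ 2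
        ≤ ∑ k ∈ Finset.Ioo 0 n, ((k : ℝ) ^ 2)⁻¹ := by
          refine Finset.sum_le_sum fun k hk => ?_
          have hk1 : 1 ≤ k := Nat.succ_le_of_lt (Finset.mem_Ioo.mp hk).1
          have hk' : (1 : ℝ) ≤ (k : ℝ) := by exact_mod_cast hk1
          rw [div_pow, Real.sq_sqrt (by positivity)]
          rw [div_le_iff₀ (by positivity), inv_mul_eq_div, le_div_iff₀ (by positivity)]
          nlinarith
      _ ≤ 2 / ((0 : ℕ) + 1) := sum_Ioo_inv_sq_le 0 n
      _ = 2 := by norm_num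
  have hB : 0 ≤ ∫ x in (-1 : ℝ)..1, g x ^ 2 := integral_nonneg (by norm_num) fun x _ => sq_nonneg _
  calc ∑ k ∈ range n, |fourierLegendre f k| * ((k : ℝ) * (k + 1) / 2)
      ≤ ∑ k ∈ Finset.Ioo 0 n, |fourierLegendre f k| * ((k : ℝ) * (k + 1) / 2) := h1
    _ ≤ Real.sqrt (∑ k ∈ Finset.Ioo 0 n, (|fourierLegendre g k| * Real.sqrt (2 / (2 * (k : ℝ) + 1))) ^ 2)
        * Real.sqrt (∑ k ∈ Finset.Ioo 0 n,
          (Real.sqrt ((2 * (k : ℝ) + 1) / 2) / (2 * ((k : ℝ) * ((k : ℝ) + 1)))) ^ 2) := h3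
    _ ≤ Real.sqrt (∫ x in (-1 : ℝ)..1, g x ^ 2) * Real.sqrt 2 := by gcongr
    _ = Real.sqrt 2 * Real.sqrt (∫ x in (-1 : ℝ)..1, g x ^ 2) := mul_comm _ _

include h₁ h₂ h₃ h₄ h₄c in
/-- **`Σ_k |c_k(f)| k(k + 1)/2 < ∞`** for a `C⁴` function: the differentiated series has a summable majorant. -/
theorem summable_abs_fourierLegendre_mul_deriv_bound :
    Summable (fun k => |fourierLegendre f k| * ((k : ℝ) * (k + 1) / 2)) :=
  summable_of_sum_range_le (fun _ => by positivity) (sum_abs_fourierLegendre_mul_le h₁ h₂ h₃ h₄ h₄c)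

include h₁ h₂ h₃ h₄ h₄c in
/-- **The differentiated series converges uniformly on `[−1, 1]`** to `Σ_k c_k(f) P′_k` (Weierstrass M-test). -/
theorem tendstoUniformlyOn_partialSumDeriv_tsum :
    TendstoUniformlyOn (fun d x => partialSumDeriv f d x) (fun x => ∑' k, fourierLegendre f k * legQ k x) atTop
      (Icc (-1 : ℝ) 1) := by
  have h := tendstoUniformlyOn_tsum_nat (summable_abs_fourierLegendre_mul_deriv_bound h₁ h₂ h₃ h₄ h₄c)
    (f := fun k x => fourierLegendre f k * legQ k x) (s := Icc (-1 : ℝ) 1)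
    fun k x hx => norm_deriv_term_le f k hx
  intro u hu
  exact (tendsto_add_atTop_nat 1).eventually (h u hu)

include h₁ h₂ h₃ h₄ h₄c in
/-- The sum of the differentiated series is continuous on `[−1, 1]`. -/
theorem continuousOn_tsum_deriv :
    ContinuousOn (fun x => ∑' k, fourierLegendre f k * legQ k x) (Icc (-1 : ℝ) 1) :=
  continuousOn_tsum (fun k => (continuous_const.mul (continuous_legQ k)).continuousOn)
    (summable_abs_fourierLegendre_mul_deriv_bound h₁ h₂ h₃ h₄ h₄c) fun k _ hx => norm_deriv_term_le f k hx

include h₁ h₂ h₃ h₄ h₄c in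
/-- **`f′(y) = Σ_k c_k(f) P′_k(y)` on the open interval `(−1, 1)`** (Mathlib's `hasDerivAt_tsum_of_isPreconnected`
applied to `Σ_k c_k(f) P_k = f`). -/
theorem deriv_eq_tsum_of_mem_Ioo {y : ℝ} (hy : y ∈ Ioo (-1 : ℝ) 1) :
    f₁ y = ∑' k, fourierLegendre f k * legQ k y := by
  have c₂ : ContinuousOn f₂ (Icc (-1 : ℝ) 1) := fun x hx => (h₃ x hx).continuousAt.continuousWithinAt
  have hsum : Summable (fun k => fourierLegendre f k * legP k 0) :=
    Summable.of_norm_bounded (summable_abs_fourierLegendre h₁ h₂ c₂) fun k => norm_term_le k (by norm_num)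
  have hD : HasDerivAt (fun z => ∑' k, fourierLegendre f k * legP k z) (∑' k, fourierLegendre f k * legQ k y) y :=
    hasDerivAt_tsum_of_isPreconnected (summable_abs_fourierLegendre_mul_deriv_bound h₁ h₂ h₃ h₄ h₄c) isOpen_Ioo
      isPreconnected_Ioo (g := fun k z => fourierLegendre f k * legP k z)
      (g' := fun k z => fourierLegendre f k * legQ k z)
      (fun k z _ => (hasDerivAt_legP k z).const_mul _)
      (fun k z hz => norm_deriv_term_le f k (Set.Ioo_subset_Icc_self hz)) (y₀ := 0) (by norm_num) hsum hy
  -- `f = Σ c_k P_k` on a neighbourhood of `y`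
  have hEq : (fun z => ∑' k, fourierLegendre f k * legP k z) =ᶠ[𝓝 y] f := by
    filter_upwards [Ioo_mem_nhds hy.1 hy.2] with z hz
    exact (eqOn_tsum h₁ h₂ c₂ (Set.Ioo_subset_Icc_self hz)).symm
  have hDf : HasDerivAt f (∑' k, fourierLegendre f k * legQ k y) y := hD.congr_of_eventuallyEq hEq.symm
  exact (h₁ y (Set.Ioo_subset_Icc_self hy)).unique hDf

include h₁ h₂ h₃ h₄ h₄c in
/-- **`f′(x) = Σ_k c_k(f) P′_k(x)` for every `x ∈ [−1, 1]`** (continuity extends the identity from `(−1, 1)`). -/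
theorem eqOn_deriv_tsum : EqOn f₁ (fun x => ∑' k, fourierLegendre f k * legQ k x) (Icc (-1 : ℝ) 1) := by
  have c₁ : ContinuousOn f₁ (Icc (-1 : ℝ) 1) := fun x hx => (h₂ x hx).continuousAt.continuousWithinAt
  refine Set.EqOn.of_subset_closure (s := Ioo (-1 : ℝ) 1) ?_ c₁ (continuousOn_tsum_deriv h₁ h₂ h₃ h₄ h₄c)
    Set.Ioo_subset_Icc_self ?_
  · exact fun y hy => deriv_eq_tsum_of_mem_Ioo h₁ h₂ h₃ h₄ h₄c hy
  · rw [closure_Ioo (by norm_num)]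

include h₁ h₂ h₃ h₄ h₄c in
/-- **`Σ_k c_k(f) P′_k(x) = f′(x)`** for every `x ∈ [−1, 1]`, as an absolutely convergent series. -/
theorem hasSum_fourierLegendre_mul_legQ {x : ℝ} (hx : x ∈ Icc (-1 : ℝ) 1) :
    HasSum (fun k => fourierLegendre f k * legQ k x) (f₁ x) := by
  have hs : Summable (fun k => fourierLegendre f k * legQ k x) :=
    Summable.of_norm_bounded (summable_abs_fourierLegendre_mul_deriv_bound h₁ h₂ h₃ h₄ h₄c)
      fun k => norm_deriv_term_le f k hx
  rw [eqOn_deriv_tsum h₁ h₂ h₃ h₄ h₄c hx]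
  exact hs.hasSum

include h₁ h₂ h₃ h₄ h₄c in
/-- **TERMWISE DIFFERENTIATION**: `(S_d f)′ → f′` uniformly on `[−1, 1]`. -/
theorem tendstoUniformlyOn_partialSumDeriv :
    TendstoUniformlyOn (fun d x => partialSumDeriv f d x) f₁ atTop (Icc (-1 : ℝ) 1) :=
  (tendstoUniformlyOn_partialSumDeriv_tsum h₁ h₂ h₃ h₄ h₄c).congr_right (eqOn_deriv_tsum h₁ h₂ h₃ h₄ h₄c).symm

end C4

/-! ### Every `C⁴` function on `ℝ` -/

/-- **`(deriv f)(x) = Σ_k c_k(f) P′_k(x)` on `[−1, 1]` for every `f ∈ C⁴(ℝ)`.** -/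
theorem eqOn_deriv_tsum_of_contDiff {f : ℝ → ℝ} (hf : ContDiff ℝ 4 f) :
    EqOn (deriv f) (fun x => ∑' k, fourierLegendre f k * legQ k x) (Icc (-1 : ℝ) 1) :=
  let ⟨h₁, h₂, h₃, h₄, h₄c⟩ := hasDerivAt_of_contDiff4 hf
  eqOn_deriv_tsum h₁ h₂ h₃ h₄ h₄c

/-- **`(S_d f)′ → deriv f` uniformly on `[−1, 1]` for every `f ∈ C⁴(ℝ)`.** -/
theorem tendstoUniformlyOn_partialSumDeriv_of_contDiff {f : ℝ → ℝ} (hf : ContDiff ℝ 4 f) :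
    TendstoUniformlyOn (fun d x => partialSumDeriv f d x) (deriv f) atTop (Icc (-1 : ℝ) 1) :=
  let ⟨h₁, h₂, h₃, h₄, h₄c⟩ := hasDerivAt_of_contDiff4 hf
  tendstoUniformlyOn_partialSumDeriv h₁ h₂ h₃ h₄ h₄c

end Summit.Ventures.HodgeRepro2.T5SU11LegendreSeriesDeriv
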